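import Summits.QuantumFields.BalabanUV.Beta.FP.FineSplitJunctionMajorant
import Summits.QuantumFields.BalabanUV.Beta.FP.GhostLoopCountingWindow
import Summits.QuantumFields.BalabanUV.Beta.FP.GhostLoopCountingGramWords

/-!
# `BalabanUV.Beta.FP.FineSplitJunctionShapes` — road «FP» for binder row D1, row KER-γ «THE JUNCTION» ∕ (α2) sub-row **α2-c** «GHOST» (b): THE LEDGER LINE OF
# F′ (`FineSplitJunctionMajorant.rem_of_majorant`, p253277) FOR THE FOUR POINTWISE SHAPES OF A NEAR-TABLE PIECE — WINDOW PROFILE ((g1) the window mismatch of the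
# ghost bubble), ULTRA-LOCAL ((g3) the ghost tadpole), ALL-MASSIVE ((g5)(g5′) the Gram ∕ `QQᵀ` words) and FAR-SUPPORTED ((g2)-type words) — each read BY NAME from
# the (Mκ) letter the one-leg ghost engines already certify (`GhostLoopCountingWindow.majorantLetter_window`, `GhostLoopCountingFar.majorantLetter_local` ∕
# `majorantLetter_far`, `GhostLoopCountingGramWords.majorantLetter_massive`) at the anchor `0` and blocking `N`: the `hLgh` members of the non-MIX ghost pieces
# (and of any gluon word of the same shapes) in the junction's two-leg majorant currency, N-powers DISPLAYED

HONEST DEPENDENCY (page 1, mandatory): continuum YM on T⁴ ⇐ BetaPertH ∧ nine spine estimates (0/9 proved); BetaPertH ⇐ (D1) ∧ (D4) ∧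
CAP+tail; G-an2-4 gates asym, D1 and NE2/3/4.  HONEST FRAMING (cell contract, verbatim): «discharging `BetaPertH` makes Bałaban's UV
stability UNCONDITIONAL — a real constructive-QFT result; it is NOT the continuum limit and NOT the Clay problem.»  THIS MODULE is [folklore] plumbing BY NAME on
`ℤ⁴`: an ABSTRACT matrix two-point piece `G : EKer₂ 4` (block-periodic — F′'s `hGper`), columns `colH K N` of a block-covariant `K` with absolutely summable END
columns and the letters (J)(J′), and ONE pointwise shape letter per theorem; the (Mκ) letters are the tree's, the composition is F′'s `rem_of_majorant`.  It defines
nothing, asserts nothing about Bałaban's constrained objects, cites nothing, mints no `Prop` fact, 0 sorry.  The N-powers `N⁴·(1+80Nw)`, `N⁴·(2r+1)⁴`, `N⁴·N⁴`,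
`N²` are DISPLAYED: the pieces' letters `C` carry their own units (row RHOA-6e ∕ (LEDGER-gh) instance bookkeeping), exactly as in the one-leg engines.  NOT (H2), NOT
the (LEDGER)'s numbers, NOT hsplit, NOT (ASYMP), NOT D1; 0∕4 row-D1 binders; NOT BetaPertH, NOT continuum, NOT Clay.

ABSOLUTE RULE (cell charter, verbatim): «No internally-minted statement may enter as a cited fact. Every hypothesis is either kernel-proved in this
package or a verbatim quotation of a PUBLISHED theorem with page reference. The manuscript(s) under audit are NOT citable for their own disputed
steps — they are the thing under adjudication; programme-internal (2001/route/tribunal) claims are never citable.»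

WHY ONE GENERIC FILE (and not one data def per piece as for the four ghost MIX words, `GhostMixPieces`∕`GhostMixPiece{Quartic,Cubic,Gamma}` p254977∕p255173∕p255178∕
p255190): the non-MIX ghost pieces' constituents are ABSTRACT legs already in their engines — (g1) `c·L_R(b,b′)·L_F(b′−b)` (one difference per leg,
`GhostLoopCountingWindow` BINDING CHECK), (g3) a range-`r` kernel, (g5) the Gram letters over a finite coarse set (a MODEL word, not block-periodic as typed) — so a
data def adds nothing the (LEDGER) can consume; the `(c,e)`-tables enter as `G` with their shape letter, as leaf-01's `WindowedWordLedger` (p254927) does for the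
windowed gluon words with BOUNDED legs.  Common currency (F′ §2, VERBATIM): `0 < δ`, `1 ≤ N`; `hKcov : ∀ t, shiftK (−(N•t)) K = K`; `hcol : ∀ κ′ l, Summable (x ↦
|colOf K κ′ l x|)`; `hGper : ∀ c e, IsBlockPeriodic N (G c e)`; (J) `|colH K N a 0 c p| ≤ C_J·e^{−(δ∕N)‖p − N•0‖∞}`; (J′) `Σ_{u∈S′}(1 + (‖x − N•u‖∞∕N)²)·|colH K N b u
e x| ≤ C_J′`; conclusion `∀ S′, Σ_{u∈S′}‖u‖∞²·|dressedEntryP (c a′ ↦ colH K N a′ 0 c) G (N•(−u)) a b| ≤ 16·(3·C_J·C_J′·(1 + 16∕δ²)·Aκ)`, `Θ := 1 + 480·e^{δ∕4}·(4∕δ)⁴`.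

CONTENT ([folklore]):
* §1 **`rem_of_windowShape`** — (win-0) `Nw < ‖x−p‖∞ → G c e p x = 0`, (win) `‖x−p‖∞ ≤ Nw → |G c e p x| ≤ C∕(‖x−p‖∞+1)³` ⟹ `Aκ = Θ·N⁴·((1+80Nw)·((1+(Nw∕N)²)·C))`.
* §2 **`rem_of_localShape`** — (loc-0) `r < ‖x−p‖∞ → G c e p x = 0`, (loc) `‖x−p‖∞ ≤ r → |G c e p x| ≤ C_loc` ⟹ `Aκ = Θ·N⁴·((2r+1)⁴·((1+(r∕N)²)·C_loc))`.
* §3 **`rem_of_massiveShape`** — (mass) `|G c e p x| ≤ C·e^{−(ξ∕N)‖x−p‖∞}` everywhere ⟹ `Aκ = Θ·N⁴·(C·(c₃(ξ)+c₅(ξ))·N⁴)`, `c₃(ξ) = 1+480e^{ξ∕2}(2∕ξ)⁴`,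
  `c₅(ξ) = 1+9600e^{ξ∕2}(2∕ξ)⁶`.
* §4 **`rem_of_farShape`** — (far-0) `‖x−p‖∞ ≤ N → G c e p x = 0`, (far) `N < ‖x−p‖∞ → |G c e p x| ≤ C·‖x−p‖∞⁻⁶·e^{−(ξ∕N)‖x−p‖∞}` ⟹ `Aκ = Θ·(160·C·(1+1∕ξ))·N²`.
Provenance: D1 formalisation swarm LEAF PROVER 05, unit `b2b-balaban-beta-d1-formalise-leaf-05` gen 16, 2026-08-21, road FP row KER-γ (α2) sub-row α2-c (b) (lineage menu
of the g15 CLOSING ADDENDUM; INTENT journal 2026-08-21T08:37Z); «not in print; our bookkeeping»; no existing file touched.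
-/

noncomputable section

namespace Summit.QuantumFields.BalabanUV.Beta.FP.FineSplitJunctionShapes

open Finset Real
open scoped BigOperators
open Literature.MathematicalPhysics.QuantumFieldTheory.Balaban1983to89
open Literature.MathematicalPhysics.QuantumFieldTheory.Balaban1983to89.Beta
open ExpKernelCalculus (Site MKer shiftK)
open OneStepResolventKernel (Fib)
open OneStepKernelFamily (colH)
open DyadicShell (Pt supNorm)
open Summit.QuantumFields.BalabanUV.Beta.D1BFx.MomentTransferPeriodic (IsBlockPeriodic)
open Summit.QuantumFields.BalabanUV.Beta.D1BFx.MomentTransferPeriodicEntry (EKer₂ dressedEntryP)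
open Summit.QuantumFields.BalabanUV.Beta.FP.TransportInfinityM (colOf)
open Summit.QuantumFields.BalabanUV.Beta.FP.MixLoopPowerCounting (supNorm_cast_nonneg)
open Summit.QuantumFields.BalabanUV.Beta.FP.FineSplitJunctionMajorant (rem_of_majorant)
open Summit.QuantumFields.BalabanUV.Beta.FP.GhostLoopCountingWindow (majorantLetter_window)
open Summit.QuantumFields.BalabanUV.Beta.FP.GhostLoopCountingFar (majorantLetter_local majorantLetter_far)
open Summit.QuantumFields.BalabanUV.Beta.FP.GhostLoopCountingGramWords (majorantLetter_massive)

variable {N : ℕ} {K : MKer (3 + 1) (Fib 3)} {G : EKer₂ 4} {a b : Fin 4} {C_J C_J' δ : ℝ}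

/-! ## §1 The window-profile shape ((g1): the window mismatch of the ghost bubble) -/

section Window

variable {C : ℝ} {Nw : ℕ}

/-- [folklore] a window-profile piece is bounded entrywise (F′'s `hGb`): `|G c e s s′| ≤ C`. -/
theorem bounded_of_windowShape (hC : 0 ≤ C)
    (hG0 : ∀ (c e : Fin 4) (p x : Pt), Nw < supNorm (x - p) → G c e p x = 0)
    (hGwin : ∀ (c e : Fin 4) (p x : Pt), supNorm (x - p) ≤ Nw → |G c e p x| ≤ C / ((supNorm (x - p) : ℝ) + 1) ^ 3)
    (c e : Fin 4) : ∃ A, ∀ s s', |G c e s s'| ≤ A := by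
  refine ⟨C, fun s s' => ?_⟩
  by_cases h : supNorm (s' - s) ≤ Nw
  · refine (hGwin c e s s' h).trans (div_le_self hC ?_)
    exact one_le_pow₀ (by linarith [supNorm_cast_nonneg (s' - s)])
  · rw [hG0 c e s s' (not_le.mp h), abs_zero]
    exact hC

/-- **THE LEDGER LINE OF A WINDOW-PROFILE PIECE** [folklore] (the `hLgh` member for (g1)): F′'s currency (`0 < δ`, `1 ≤ N`, `K` block-covariant with absolutely
summable END columns, `G` block-periodic entrywise, columns with (J) at the anchor `0` and (J′)) and the window-profile letters (win-0) `Nw < ‖x−p‖∞ → G c e p x = 0`,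
(win) `‖x−p‖∞ ≤ Nw → |G c e p x| ≤ C∕(‖x−p‖∞+1)³` (`0 ≤ C`) ⟹
`∀ S′, Σ_{u∈S′}‖u‖∞²·|dressedEntryP (c a′ ↦ colH K N a′ 0 c) G (N•(−u)) a b| ≤ 16·(3·C_J·C_J′·(1+16∕δ²)·((1+480e^{δ∕4}(4∕δ)⁴)·N⁴·((1+80Nw)·((1+(Nw∕N)²)·C))))`
— `rem_of_majorant` at `κ := |G|` with (Mκ) := `GhostLoopCountingWindow.majorantLetter_window` (anchor `0`, blocking `N`, window `Nw`) BY NAME; NO logarithm of `Nw`. -/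
theorem rem_of_windowShape (hδ : 0 < δ) (hN : 1 ≤ N) (hC : 0 ≤ C)
    (hKcov : ∀ t : Fin (3 + 1) → ℤ, shiftK (-((N : ℤ) • t)) K = K)
    (hcol : ∀ κ' l : Fin 4, Summable fun x => |colOf K κ' l x|)
    (hGper : ∀ c e, IsBlockPeriodic N (G c e))
    (hG0 : ∀ (c e : Fin 4) (p x : Pt), Nw < supNorm (x - p) → G c e p x = 0)
    (hGwin : ∀ (c e : Fin 4) (p x : Pt), supNorm (x - p) ≤ Nw → |G c e p x| ≤ C / ((supNorm (x - p) : ℝ) + 1) ^ 3)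
    (hJ : ∀ (c : Fin 4) (p : Pt), |colH K N a 0 c p| ≤ C_J * Real.exp (-(δ / N) * (supNorm (p - (N : ℤ) • (0 : Pt)) : ℝ)))
    (hJ' : ∀ (e : Fin 4) (S' : Finset Pt) (x : Pt), ∑ u ∈ S', (1 + ((supNorm (x - (N : ℤ) • u) : ℝ) / N) ^ 2) * |colH K N b u e x| ≤ C_J') :
    ∀ S' : Finset Pt, ∑ u ∈ S', (supNorm u : ℝ) ^ 2 * |dressedEntryP (fun c a' => colH K N a' 0 c) G ((N : ℤ) • (-u)) a b|
      ≤ 16 * (3 * C_J * C_J' * (1 + 16 / δ ^ 2) *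
          ((1 + 480 * Real.exp (δ / 4) * (4 / δ) ^ 4) * (N : ℝ) ^ 4 * ((1 + 80 * (Nw : ℝ)) * ((1 + ((Nw : ℝ) / N) ^ 2) * C)))) :=
  rem_of_majorant (κ := fun c e p x => |G c e p x|) hδ hN hKcov hcol hGper (bounded_of_windowShape hC hG0 hGwin)
    (fun _ _ _ _ => le_rfl) (fun c e A => majorantLetter_window hδ hC hN Nw A 0 (hG0 c e) (hGwin c e)) hJ hJ'

end Window

/-! ## §2 The ultra-local shape ((g3): the ghost tadpole) -/

section Local

variable {C_loc : ℝ} {r : ℕ}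

/-- [folklore] an ultra-local piece is bounded entrywise (F′'s `hGb`): `|G c e s s′| ≤ C_loc`. -/
theorem bounded_of_localShape (hC : 0 ≤ C_loc)
    (hG0 : ∀ (c e : Fin 4) (p x : Pt), r < supNorm (x - p) → G c e p x = 0)
    (hGloc : ∀ (c e : Fin 4) (p x : Pt), supNorm (x - p) ≤ r → |G c e p x| ≤ C_loc)
    (c e : Fin 4) : ∃ A, ∀ s s', |G c e s s'| ≤ A := by
  refine ⟨C_loc, fun s s' => ?_⟩
  by_cases h : supNorm (s' - s) ≤ r
  · exact hGloc c e s s' h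
  · rw [hG0 c e s s' (not_le.mp h), abs_zero]
    exact hC

/-- **THE LEDGER LINE OF AN ULTRA-LOCAL PIECE** [folklore] (the `hLgh` member for (g3)): F′'s currency and the local letters (loc-0) `r < ‖x−p‖∞ → G c e p x = 0`,
(loc) `‖x−p‖∞ ≤ r → |G c e p x| ≤ C_loc` (`0 ≤ C_loc`) ⟹
`∀ S′, Σ_{u∈S′}‖u‖∞²·|dressedEntryP (c a′ ↦ colH K N a′ 0 c) G (N•(−u)) a b| ≤ 16·(3·C_J·C_J′·(1+16∕δ²)·((1+480e^{δ∕4}(4∕δ)⁴)·N⁴·((2r+1)⁴·((1+(r∕N)²)·C_loc))))`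
— `rem_of_majorant` at `κ := |G|` with (Mκ) := `GhostLoopCountingFar.majorantLetter_local` (anchor `0`, blocking `N`, range `r`) BY NAME. -/
theorem rem_of_localShape (hδ : 0 < δ) (hN : 1 ≤ N) (hC : 0 ≤ C_loc)
    (hKcov : ∀ t : Fin (3 + 1) → ℤ, shiftK (-((N : ℤ) • t)) K = K)
    (hcol : ∀ κ' l : Fin 4, Summable fun x => |colOf K κ' l x|)
    (hGper : ∀ c e, IsBlockPeriodic N (G c e))
    (hG0 : ∀ (c e : Fin 4) (p x : Pt), r < supNorm (x - p) → G c e p x = 0)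
    (hGloc : ∀ (c e : Fin 4) (p x : Pt), supNorm (x - p) ≤ r → |G c e p x| ≤ C_loc)
    (hJ : ∀ (c : Fin 4) (p : Pt), |colH K N a 0 c p| ≤ C_J * Real.exp (-(δ / N) * (supNorm (p - (N : ℤ) • (0 : Pt)) : ℝ)))
    (hJ' : ∀ (e : Fin 4) (S' : Finset Pt) (x : Pt), ∑ u ∈ S', (1 + ((supNorm (x - (N : ℤ) • u) : ℝ) / N) ^ 2) * |colH K N b u e x| ≤ C_J') :
    ∀ S' : Finset Pt, ∑ u ∈ S', (supNorm u : ℝ) ^ 2 * |dressedEntryP (fun c a' => colH K N a' 0 c) G ((N : ℤ) • (-u)) a b|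
      ≤ 16 * (3 * C_J * C_J' * (1 + 16 / δ ^ 2) *
          ((1 + 480 * Real.exp (δ / 4) * (4 / δ) ^ 4) * (N : ℝ) ^ 4 * ((2 * (r : ℝ) + 1) ^ 4 * ((1 + ((r : ℝ) / N) ^ 2) * C_loc)))) :=
  rem_of_majorant (κ := fun c e p x => |G c e p x|) hδ hN hKcov hcol hGper (bounded_of_localShape hC hG0 hGloc)
    (fun _ _ _ _ => le_rfl) (fun c e A => majorantLetter_local hδ hC hN r A 0 (hG0 c e) (hGloc c e)) hJ hJ'

end Local

/-! ## §3 The all-massive shape ((g5)(g5′): the Gram and `QQᵀ` words, windowed or not) -/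

section Massive

variable {C ξ : ℝ}

/-- [folklore] an all-massive piece is bounded entrywise (F′'s `hGb`): `|G c e s s′| ≤ C` (`0 ≤ ξ`). -/
theorem bounded_of_massiveShape (hC : 0 ≤ C) (hξ : 0 ≤ ξ)
    (hGm : ∀ (c e : Fin 4) (p x : Pt), |G c e p x| ≤ C * Real.exp (-(ξ / N) * (supNorm (x - p) : ℝ)))
    (c e : Fin 4) : ∃ A, ∀ s s', |G c e s s'| ≤ A := by
  refine ⟨C, fun s s' => (hGm c e s s').trans ?_⟩
  have hexp : Real.exp (-(ξ / N) * (supNorm (s' - s) : ℝ)) ≤ 1 := by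
    rw [Real.exp_le_one_iff, neg_mul, neg_nonpos]
    exact mul_nonneg (div_nonneg hξ (Nat.cast_nonneg _)) (supNorm_cast_nonneg _)
  calc C * Real.exp (-(ξ / N) * (supNorm (s' - s) : ℝ)) ≤ C * 1 := mul_le_mul_of_nonneg_left hexp hC
    _ = C := mul_one C

/-- **THE LEDGER LINE OF AN ALL-MASSIVE PIECE** [folklore] (the `hLgh` member for (g5)(g5′)): F′'s currency and the massive letter (mass)
`|G c e p x| ≤ C·e^{−(ξ∕N)‖x−p‖∞}` for ALL `p, x` (`0 ≤ C`, `0 < ξ`; a window cut-off only helps and need not be displayed) ⟹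
`∀ S′, Σ_{u∈S′}‖u‖∞²·|dressedEntryP (c a′ ↦ colH K N a′ 0 c) G (N•(−u)) a b|
   ≤ 16·(3·C_J·C_J′·(1+16∕δ²)·((1+480e^{δ∕4}(4∕δ)⁴)·N⁴·(C·((1+480e^{ξ∕2}(2∕ξ)⁴) + (1+9600e^{ξ∕2}(2∕ξ)⁶))·N⁴)))`
— `rem_of_majorant` at `κ := |G|` with (Mκ) := `GhostLoopCountingGramWords.majorantLetter_massive` (anchor `0`, blocking `N`) BY NAME; powers `N⁴·N⁴` displayed. -/
theorem rem_of_massiveShape (hδ : 0 < δ) (hN : 1 ≤ N) (hC : 0 ≤ C) (hξ : 0 < ξ)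
    (hKcov : ∀ t : Fin (3 + 1) → ℤ, shiftK (-((N : ℤ) • t)) K = K)
    (hcol : ∀ κ' l : Fin 4, Summable fun x => |colOf K κ' l x|)
    (hGper : ∀ c e, IsBlockPeriodic N (G c e))
    (hGm : ∀ (c e : Fin 4) (p x : Pt), |G c e p x| ≤ C * Real.exp (-(ξ / N) * (supNorm (x - p) : ℝ)))
    (hJ : ∀ (c : Fin 4) (p : Pt), |colH K N a 0 c p| ≤ C_J * Real.exp (-(δ / N) * (supNorm (p - (N : ℤ) • (0 : Pt)) : ℝ)))
    (hJ' : ∀ (e : Fin 4) (S' : Finset Pt) (x : Pt), ∑ u ∈ S', (1 + ((supNorm (x - (N : ℤ) • u) : ℝ) / N) ^ 2) * |colH K N b u e x| ≤ C_J') :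
    ∀ S' : Finset Pt, ∑ u ∈ S', (supNorm u : ℝ) ^ 2 * |dressedEntryP (fun c a' => colH K N a' 0 c) G ((N : ℤ) • (-u)) a b|
      ≤ 16 * (3 * C_J * C_J' * (1 + 16 / δ ^ 2) *
          ((1 + 480 * Real.exp (δ / 4) * (4 / δ) ^ 4) * (N : ℝ) ^ 4 *
            (C * ((1 + 480 * Real.exp (ξ / 2) * (2 / ξ) ^ 4) + (1 + 9600 * Real.exp (ξ / 2) * (2 / ξ) ^ 6)) * (N : ℝ) ^ 4))) :=
  rem_of_majorant (κ := fun c e p x => |G c e p x|) hδ hN hKcov hcol hGper (bounded_of_massiveShape hC hξ.le hGm)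
    (fun _ _ _ _ => le_rfl) (fun c e A => majorantLetter_massive hδ hC hξ hN A 0 (hGm c e)) hJ hJ'

end Massive

/-! ## §4 The far-supported shape ((g2)-type words: nothing on the window, a graded massive tail beyond) -/

section FarShape

variable {C ξ : ℝ}

/-- [folklore] a far-supported piece is bounded entrywise (F′'s `hGb`): `|G c e s s′| ≤ C` (`1 ≤ N`, `0 ≤ ξ`). -/
theorem bounded_of_farShape (hN : 1 ≤ N) (hC : 0 ≤ C) (hξ : 0 ≤ ξ)
    (hG0 : ∀ (c e : Fin 4) (p x : Pt), supNorm (x - p) ≤ N → G c e p x = 0)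
    (hGfar : ∀ (c e : Fin 4) (p x : Pt), N < supNorm (x - p) →
      |G c e p x| ≤ C / (supNorm (x - p) : ℝ) ^ 6 * Real.exp (-(ξ / N) * (supNorm (x - p) : ℝ)))
    (c e : Fin 4) : ∃ A, ∀ s s', |G c e s s'| ≤ A := by
  refine ⟨C, fun s s' => ?_⟩
  by_cases h : supNorm (s' - s) ≤ N
  · rw [hG0 c e s s' h, abs_zero]
    exact hC
  · have hlt : N < supNorm (s' - s) := not_le.mp h
    have hr1 : (1 : ℝ) ≤ (supNorm (s' - s) : ℝ) := by exact_mod_cast hN.trans hlt.le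
    have hexp : Real.exp (-(ξ / N) * (supNorm (s' - s) : ℝ)) ≤ 1 := by
      rw [Real.exp_le_one_iff, neg_mul, neg_nonpos]
      exact mul_nonneg (div_nonneg hξ (Nat.cast_nonneg _)) (supNorm_cast_nonneg _)
    have hdiv : C / (supNorm (s' - s) : ℝ) ^ 6 ≤ C := div_le_self hC (one_le_pow₀ hr1)
    refine (hGfar c e s s' hlt).trans ?_
    calc C / (supNorm (s' - s) : ℝ) ^ 6 * Real.exp (-(ξ / N) * (supNorm (s' - s) : ℝ))
        ≤ C / (supNorm (s' - s) : ℝ) ^ 6 * 1 :=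
          mul_le_mul_of_nonneg_left hexp (div_nonneg hC (pow_nonneg (supNorm_cast_nonneg _) 6))
      _ ≤ C := by rw [mul_one]; exact hdiv

/-- **THE LEDGER LINE OF A FAR-SUPPORTED PIECE** [folklore]: F′'s currency and the far letters (far-0) `‖x−p‖∞ ≤ N → G c e p x = 0`, (far)
`N < ‖x−p‖∞ → |G c e p x| ≤ C·‖x−p‖∞⁻⁶·e^{−(ξ∕N)‖x−p‖∞}` (`0 ≤ C`, `0 < ξ`) ⟹
`∀ S′, Σ_{u∈S′}‖u‖∞²·|dressedEntryP (c a′ ↦ colH K N a′ 0 c) G (N•(−u)) a b| ≤ 16·(3·C_J·C_J′·(1+16∕δ²)·((1+480e^{δ∕4}(4∕δ)⁴)·(160·C·(1+1∕ξ))·N²))`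
— `rem_of_majorant` at `κ := |G|` with (Mκ) := `GhostLoopCountingFar.majorantLetter_far` (anchor `0`, blocking `N`) BY NAME; powers `N⁴·N⁻²` displayed. -/
theorem rem_of_farShape (hδ : 0 < δ) (hN : 1 ≤ N) (hC : 0 ≤ C) (hξ : 0 < ξ)
    (hKcov : ∀ t : Fin (3 + 1) → ℤ, shiftK (-((N : ℤ) • t)) K = K)
    (hcol : ∀ κ' l : Fin 4, Summable fun x => |colOf K κ' l x|)
    (hGper : ∀ c e, IsBlockPeriodic N (G c e))
    (hG0 : ∀ (c e : Fin 4) (p x : Pt), supNorm (x - p) ≤ N → G c e p x = 0)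
    (hGfar : ∀ (c e : Fin 4) (p x : Pt), N < supNorm (x - p) →
      |G c e p x| ≤ C / (supNorm (x - p) : ℝ) ^ 6 * Real.exp (-(ξ / N) * (supNorm (x - p) : ℝ)))
    (hJ : ∀ (c : Fin 4) (p : Pt), |colH K N a 0 c p| ≤ C_J * Real.exp (-(δ / N) * (supNorm (p - (N : ℤ) • (0 : Pt)) : ℝ)))
    (hJ' : ∀ (e : Fin 4) (S' : Finset Pt) (x : Pt), ∑ u ∈ S', (1 + ((supNorm (x - (N : ℤ) • u) : ℝ) / N) ^ 2) * |colH K N b u e x| ≤ C_J') :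
    ∀ S' : Finset Pt, ∑ u ∈ S', (supNorm u : ℝ) ^ 2 * |dressedEntryP (fun c a' => colH K N a' 0 c) G ((N : ℤ) • (-u)) a b|
      ≤ 16 * (3 * C_J * C_J' * (1 + 16 / δ ^ 2) *
          ((1 + 480 * Real.exp (δ / 4) * (4 / δ) ^ 4) * (160 * C * (1 + 1 / ξ)) * (N : ℝ) ^ 2)) :=
  rem_of_majorant (κ := fun c e p x => |G c e p x|) hδ hN hKcov hcol hGper (bounded_of_farShape hN hC hξ.le hG0 hGfar)
    (fun _ _ _ _ => le_rfl) (fun c e A => majorantLetter_far hδ hC hξ hN A 0 (hG0 c e) (hGfar c e)) hJ hJ'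

end FarShape

end Summit.QuantumFields.BalabanUV.Beta.FP.FineSplitJunctionShapes

end
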